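import Mathlib
import Literature.Analysis.FluidPDE.SelfSimilarEulerProfile

/-!
# Hoop core — rotation covariance of self-similar Euler profiles (R48 plate t51-PIC `ProfileIsometryConj`)

Sub-problem `NavierStokesRegularity`, crux `PowerGaugeEulerLiouville` (a crux CLASS; nothing here is class-specific).  The profile system
`(1−γ)V + DV[γ(y−c) + V] + ∇P = 0`, `div V = 0` (`Literature.Analysis.FluidPDE.IsSelfSimilarEulerProfile γ c V P`) is covariant under linear isometries:
conjugating by `L : E3 ≃ₗᵢ[ℝ] E3` gives the profile `(L⁻¹ ∘ V ∘ L, P ∘ L)` with centre `L⁻¹ c` (`isSelfSimilarEulerProfile_conj_linearIsometryEquiv`); with the tree's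
translation `comp_add_right` and centre gauge `recenter` this places the hoop/axis laws (`…HoopDefs`: cylinders about the `e_z`-axis) about EVERY line.
`profileIsometryConj` is nsreg-p2 ROUND-48's `NsregP2.R48.ProfileIsometryConj γ` text verbatim (centre `0`).
-/

noncomputable section

set_option linter.dupNamespace false

open Set Function
open scoped InnerProductSpace RealInnerProductSpace

namespace Summit.NavierStokesRegularity.NavierStokesRegularity.Theorems.PowerGaugeEulerLiouville.HoopCore

open Literature.Analysis Literature.Analysis.FluidPDE

/-- The adjoint of a linear isometry equivalence is its inverse: `⟪L a, b⟫ = ⟪a, L⁻¹ b⟫`. [folklore] -/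
theorem inner_linearIsometryEquiv_left (L : EuclideanSpace ℝ (Fin 3) ≃ₗᵢ[ℝ] EuclideanSpace ℝ (Fin 3)) (a b : EuclideanSpace ℝ (Fin 3)) :
    ⟪L a, b⟫ = ⟪a, L.symm b⟫ := by
  conv_lhs => rw [← L.apply_symm_apply b]
  rw [LinearIsometryEquiv.inner_map_map]

/-- **ROTATION COVARIANCE (general centre)**: if `(V, P)` is a self-similar Euler profile with exponent `γ` and centre `c`, then for every linear isometry
`L` of `ℝ³` the conjugate `(y ↦ L⁻¹(V(L y)), P ∘ L)` is a profile with exponent `γ` and centre `L⁻¹ c` (chain rule; `div` is a similarity invariant; the gradient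
of `P ∘ L` is `L⁻¹ ∇P ∘ L`). [folklore] -/
theorem isSelfSimilarEulerProfile_conj_linearIsometryEquiv {γ : ℝ} {c : EuclideanSpace ℝ (Fin 3)}
    {V : EuclideanSpace ℝ (Fin 3) → EuclideanSpace ℝ (Fin 3)} {P : EuclideanSpace ℝ (Fin 3) → ℝ} (h : IsSelfSimilarEulerProfile γ c V P)
    (L : EuclideanSpace ℝ (Fin 3) ≃ₗᵢ[ℝ] EuclideanSpace ℝ (Fin 3)) :
    IsSelfSimilarEulerProfile γ (L.symm c) (fun y => L.symm (V (L y))) (fun y => P (L y)) := by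
  set M : EuclideanSpace ℝ (Fin 3) ≃L[ℝ] EuclideanSpace ℝ (Fin 3) := L.toContinuousLinearEquiv with hM_def
  have hM : ∀ y, M y = L y := fun y => rfl
  have hMs : ∀ y, M.symm y = L.symm y := fun y => rfl
  have hVd : Differentiable ℝ V := h.contDiff_velocity.differentiable (by norm_num)
  have hPd : Differentiable ℝ P := h.contDiff_pressure.differentiable one_ne_zero
  -- the two derivatives
  have hDV : ∀ y, fderiv ℝ (fun y => L.symm (V (L y))) y =
      ((M.symm : EuclideanSpace ℝ (Fin 3) →L[ℝ] EuclideanSpace ℝ (Fin 3)).comp (fderiv ℝ V (L y))).comp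
        (M : EuclideanSpace ℝ (Fin 3) →L[ℝ] EuclideanSpace ℝ (Fin 3)) := by
    intro y
    have e : (fun y => L.symm (V (L y))) = (⇑M.symm ∘ V) ∘ ⇑M := by funext y; simp [hM, hMs]
    rw [e, ContinuousLinearEquiv.comp_right_fderiv, ContinuousLinearEquiv.comp_fderiv]
    rfl
  have hDP : ∀ y, fderiv ℝ (fun y => P (L y)) y = (fderiv ℝ P (L y)).comp (M : EuclideanSpace ℝ (Fin 3) →L[ℝ] EuclideanSpace ℝ (Fin 3)) := by
    intro y
    have e : (fun y => P (L y)) = P ∘ ⇑M := by funext y; simp [hM]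
    rw [e, ContinuousLinearEquiv.comp_right_fderiv]
    rfl
  have hgrad : ∀ y, gradient (fun y => P (L y)) y = L.symm (gradient P (L y)) := by
    intro y
    apply ext_inner_right ℝ
    intro w
    rw [gradient, InnerProductSpace.toDual_symm_apply, hDP, ContinuousLinearMap.comp_apply,
      ← L.inner_map_map (L.symm (gradient P (L y))) w, L.apply_symm_apply, gradient, InnerProductSpace.toDual_symm_apply]
    rfl
  refine ⟨?_, ?_, ?_, ?_⟩
  · exact L.symm.contDiff.comp (h.contDiff_velocity.comp L.contDiff)
  · exact h.contDiff_pressure.comp L.contDiff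
  · intro y
    have key := congrArg (fun v => L.symm v) (h.profile_eq (L y))
    simp only [map_zero] at key
    rw [hDV, hgrad]
    have ht : (M : EuclideanSpace ℝ (Fin 3) →L[ℝ] EuclideanSpace ℝ (Fin 3)) (γ • (y - L.symm c) + L.symm (V (L y))) = γ • (L y - c) + V (L y) := by
      rw [show γ • (y - L.symm c) + L.symm (V (L y)) = L.symm (γ • (L y - c) + V (L y)) by
        simp only [map_add, map_smul, map_sub, LinearIsometryEquiv.symm_apply_apply]]
      exact L.apply_symm_apply _
    simp only [ContinuousLinearMap.comp_apply, ht]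
    rw [← key]
    simp only [map_add, map_smul, ContinuousLinearEquiv.coe_coe, hMs]
  · intro y
    have e := h.divFree (L y)
    rw [divergence_eq_sum_inner_fderiv ((EuclideanSpace.basisFun (Fin 3) ℝ).map L) V] at e
    show VectorCalculus.divergence _ y = 0
    rw [divergence_eq_sum_inner_fderiv (EuclideanSpace.basisFun (Fin 3) ℝ), hDV]
    simp only [ContinuousLinearMap.comp_apply, ContinuousLinearEquiv.coe_coe, hM, hMs, OrthonormalBasis.map_apply] at e ⊢
    simpa only [inner_linearIsometryEquiv_left] using e

/-- **`ProfileIsometryConj γ`** (nsreg-p2 ROUND-48 `NsregP2.R48.ProfileIsometryConj`, text verbatim): conjugating a centre-`0` profile by a linear isometry gives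
a centre-`0` profile. [folklore] -/
theorem profileIsometryConj (γ : ℝ) :
    ∀ (L : EuclideanSpace ℝ (Fin 3) ≃ₗᵢ[ℝ] EuclideanSpace ℝ (Fin 3)) (V : EuclideanSpace ℝ (Fin 3) → EuclideanSpace ℝ (Fin 3))
      (P : EuclideanSpace ℝ (Fin 3) → ℝ), IsSelfSimilarEulerProfile γ 0 V P →
      IsSelfSimilarEulerProfile γ 0 (fun y => L.symm (V (L y))) (fun y => P (L y)) := by
  intro L V P h
  simpa only [map_zero] using isSelfSimilarEulerProfile_conj_linearIsometryEquiv h L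

end Summit.NavierStokesRegularity.NavierStokesRegularity.Theorems.PowerGaugeEulerLiouville.HoopCore

end
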